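import Literature.AlgebraicGeometry.Resolution.Temkin2008LocalizationProofs
import Literature.AlgebraicGeometry.Resolution.QuasiExcellentLocalization
import HarnessLib

/-!
# Temkin's theorem from Hironaka's alone: `Hironaka1964_local → Temkin2008`

Topic: `Literature/AlgebraicGeometry/Resolution`. Proof-only companion of `Temkin2008.lean`
(the named fact `Temkin2008`: Temkin 2008, Thm. 1.1 (i)⇒(ii) / Thm. 2.3.6, weak form — every
Noetherian quasi-excellent integral scheme with residue fields of characteristic zero has a
resolution) and of `Temkin2008LocalizationProofs.lean` (Prop. 2.3.4 proved:
`Temkin2008_prop234_holds`). Before this file the tree reached `Temkin2008` from the trust base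
{`Hironaka1964_local`, `Stacks07PV`} (`temkin2008_of_stacks07PV`) or
{`Hironaka1964_local`, `Stacks07QU`} (`temkin2008_of_localization'`): the G-ring proposition
Stacks 07PV / Tag 07QU enters only because the named fact `Temkin2008_prop234` is vendored with
Temkin's condition (iii) quantified over ALL schemes `X` of finite type over the base `k`, whose
local rings `𝒪_{X,x}` are quasi-excellent only by 07QU.

Temkin's printed proof of Prop. 2.3.4 (arXiv p. 12), however, applies condition (iii) only to
the local schemes `S = Spec 𝒪_{X,x}` at points `x` of the ONE scheme `X` being desingularized
("let `x` be a maximal point of `X ∖ U` … `S = Spec(𝒪_{X,x})`"), and for Thm. 2.3.6 that scheme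
is the quasi-excellent `X` itself over the base `k = X`, whose local rings are localizations of
the quasi-excellent rings `Γ(X, U)` — quasi-excellent by the PROVED localization clause of 07QU
(`Stacks07QU_localization_holds`, `QuasiExcellentLocalization.lean`). This file records that
sharper reading, all PROVED:

* `admitsDesingularization_of_local` — **Prop. 2.3.4 (iii)⇒(ii) for one scheme**: over a
  Noetherian quasi-excellent `k`, a `k`-scheme `X` of finite type admits a desingularization as
  soon as the blow-ups `S'` of ITS local schemes `S = Spec 𝒪_{X,x}` with `S'_sing ⊆ f⁻¹(s)`
  admit desingularizations — the Noetherian induction of `temkin2008_prop234_of_comp` verbatim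
  (maximal point of `C = X ∖ U`, flat base change to `Spec 𝒪_{X,x}`, Lemma 2.1.1, Lemma 2.1.4 =
  `IsBlowup.exists_isBlowup_comp_supported`), with the local hypothesis used exactly where the
  printed proof uses it;
* `Scheme.IsQuasiExcellent.isQuasiExcellentRing_stalk` — local rings of a quasi-excellent scheme
  are quasi-excellent (no 07QU: `𝒪_{X,x}` is a localization of `Γ(X, U)`);
* `Hironaka1964_local.admitsDesingularization_of_isBlowup_stalk` — Hironaka's theorem supplies
  the local hypothesis at the points of a quasi-excellent scheme with residue fields of
  characteristic zero (Temkin, proof of Thm. 2.3.6);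
* `temkin2008_of_hironaka1964_local : Hironaka1964_local → Temkin2008` — **the named fact
  `Temkin2008` now rests on the single leaf `Hironaka1964_local`** (Hironaka 1964, Main Theorem I
  over local quasi-excellent rings of residue characteristic zero, as used by Temkin p. 13);
  `Hironaka1964_local.admitsDesingularization` is the same conclusion in Temkin's own terms
  (Def. 2.2.6). Resolution over `X` of ALL finite type `X`-schemes (`ResolutionOver X`) is not
  claimed here: that does need 07QU for the local rings of those schemes.

## Sources

* M. Temkin, *Desingularization of quasi-excellent schemes in characteristic zero*, Adv. Math.
  219 (2008) 488–522 = arXiv:math/0703678: Prop. 2.3.4 and its proof (p. 12: "Let `f : X' → X`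
  be a `V`-admissible blow up which desingularizes the pair `(X,Z)` over an open subscheme
  `U ↪ X` … let `x` be a maximal point of `X ∖ U` … Consider the morphism of `k`-schemes
  `S = Spec(𝒪_{X,x}) → X` … By our assumptions, `(S', Z')` admits a strict desingularization"),
  Thm. 2.3.6 (p. 13: "Accordingly to proposition 2.3.4, Hironaka's result implies …"),
  §1 p. 3. [Temkin2008]
* H. Hironaka, Ann. of Math. 79 (1964), Main Theorem I. [Hironaka1964]
* The Stacks Project, Tag 07QU (localization clause). [StacksProject]
-/

noncomputable section

open CategoryTheory CategoryTheory.Limits AlgebraicGeometry TopologicalSpace IsLocalRing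

namespace Literature.AlgebraicGeometry.Resolution

universe u

/-! ## Prop. 2.3.4 for a single scheme of finite type over `k` -/

/-- **Temkin 2008, Prop. 2.3.4, (iii)⇒(ii) for one scheme** (variant (1): not embedded, `Z = ∅`,
`d = ∞`): let `k` be a Noetherian quasi-excellent scheme and `X` a `k`-scheme of finite type. If
for every point `x ∈ X` every blow-up `g : S' → S = Spec 𝒪_{X,x}` whose non-regular points lie
over the closed point admits a desingularization, then `X` admits a desingularization (an
`X_reg`-admissible blow-up with regular source). This is the printed Noetherian induction
(arXiv p. 12), which invokes condition (iii) only at (maximal) points `x` of `X ∖ U ⊆ X`; the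
Lean text is that of `temkin2008_prop234_of_comp` with the local hypothesis so restricted and
Lemma 2.1.4 supplied by `IsBlowup.exists_isBlowup_comp_supported`.
[cite: Temkin2008, Prop. 2.3.4 (proof, p. 12)] -/
theorem admitsDesingularization_of_local {k X : Scheme.{u}} [IsNoetherian k]
    (hk : Scheme.IsQuasiExcellent k) (f₀ : X ⟶ k) [LocallyOfFiniteType f₀] [QuasiCompact f₀]
    (hloc : ∀ (x : X) (S' : Scheme.{u}) (g : S' ⟶ Spec (X.presheaf.stalk x))
      (I : (Spec (X.presheaf.stalk x)).IdealSheafData), IsBlowup g I →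
      (∀ s : S', s ∉ Scheme.regularLocus S' → g s = closedPoint (X.presheaf.stalk x)) →
      Scheme.AdmitsDesingularization S') :
    Scheme.AdmitsDesingularization X := by
  -- `X` is a Noetherian scheme, its singular locus `T` is closed
  haveI : IsLocallyNoetherian X := LocallyOfFiniteType.isLocallyNoetherian f₀
  haveI : CompactSpace X := QuasiCompact.compactSpace_of_compactSpace f₀
  haveI : IsNoetherian X := {}
  set T : Set X := (Scheme.regularLocus X)ᶜ with hT
  have hTc : IsClosed T := isClosed_compl_regularLocus_of_locallyOfFiniteType f₀ hk
  -- the induction statement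
  suffices H : ∀ C : Closeds X, (C : Set X) ⊆ T →
      (∃ (X' : Scheme.{u}) (f : X' ⟶ X) (J : X.IdealSheafData), IsBlowup f J ∧
        (J.support : Set X) ⊆ T ∧ ∀ x' : X', f x' ∉ C → x' ∈ Scheme.regularLocus X') →
      Scheme.AdmitsDesingularization X by
    refine H ⟨T, hTc⟩ subset_rfl ⟨X, 𝟙 X, ⊤, isBlowup_id_top X, ?_, fun x' hx' => ?_⟩
    · simp [Scheme.IdealSheafData.support_top]
    · simpa [hT] using hx'
  intro C
  induction C using WellFoundedLT.induction with
  | ind C ih =>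
  intro hCT ⟨X', f, J, hf, hJ, hreg⟩
  -- either `X'` is already regular …
  by_cases hall : ∀ x' : X', x' ∈ Scheme.regularLocus X'
  · exact ⟨X', f, ⟨J, hf, hJ⟩, fun x' => (Scheme.mem_regularLocus x').mp (hall x')⟩
  -- … or `C` is nonempty; pick a maximal point `x` of `C`
  push Not at hall
  obtain ⟨x₁, hx₁⟩ := hall
  have hx₁C : f x₁ ∈ (C : Set X) := by
    by_contra h
    exact hx₁ (hreg x₁ h)
  obtain ⟨x, hxC, hmax⟩ := exists_maximal_point_of_isClosed C.isClosed hx₁C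
  -- `X'` is Noetherian, of finite type over `k`
  haveI : IsProper f := hf.isProper
  haveI : IsLocallyNoetherian X' := LocallyOfFiniteType.isLocallyNoetherian f
  haveI : CompactSpace X' := QuasiCompact.compactSpace_of_compactSpace f
  haveI : IsNoetherian X' := {}
  -- the local scheme `S = Spec 𝒪_{X,x}` and the pro-open pro-subscheme `S' = X' ×_X S` of `X'`
  haveI : Flat (X.fromSpecStalk x) := flat_fromSpecStalk X x
  haveI : IsNoetherian (pullback f (X.fromSpecStalk x)) := {}
  have hgb : IsBlowup (pullback.snd f (X.fromSpecStalk x)) (J.comap (X.fromSpecStalk x)) :=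
    hf.pullback_snd_of_flat (X.fromSpecStalk x)
  have hfj : ∀ s : ↑(pullback f (X.fromSpecStalk x)),
      f (pullback.fst f (X.fromSpecStalk x) s) =
        X.fromSpecStalk x (pullback.snd f (X.fromSpecStalk x) s) := fun s => by
    rw [← Scheme.Hom.comp_apply, pullback.condition, Scheme.Hom.comp_apply]
  -- `S'_sing ⊆ g⁻¹(s)`: a singular point of `S'` is singular in `X'`, hence lies over `C`, over a
  -- generization of `x`, hence over `x` by maximality
  have hsing : ∀ s : ↑(pullback f (X.fromSpecStalk x)),
      s ∉ Scheme.regularLocus (pullback f (X.fromSpecStalk x)) →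
        pullback.snd f (X.fromSpecStalk x) s = closedPoint (X.presheaf.stalk x) := by
    intro s hs
    have h1 : pullback.fst f (X.fromSpecStalk x) s ∉ Scheme.regularLocus X' := fun h =>
      hs ((mem_regularLocus_iff_pullback_fst_fromSpecStalk f x s).mpr h)
    have h2 : f (pullback.fst f (X.fromSpecStalk x) s) ∈ (C : Set X) := by
      by_contra h
      exact h1 (hreg _ h)
    have h3 : X.fromSpecStalk x (pullback.snd f (X.fromSpecStalk x) s) ⤳ x :=
      Scheme.range_fromSpecStalk.le ⟨_, rfl⟩
    have h4 : X.fromSpecStalk x (pullback.snd f (X.fromSpecStalk x) s) = x :=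
      hmax _ (hfj s ▸ h2) h3
    apply (X.fromSpecStalk x).isEmbedding.injective
    rw [h4, Scheme.fromSpecStalk_closedPoint]
  -- the local desingularization provided by the hypothesis at the point `x ∈ X`
  obtain ⟨S'', g', hdes⟩ := hloc x (pullback f (X.fromSpecStalk x))
    (pullback.snd f (X.fromSpecStalk x)) (J.comap (X.fromSpecStalk x)) hgb hsing
  obtain ⟨I', hg', hI'⟩ := hdes.exists_isBlowup
  have hS''reg := hdes.isRegular
  -- extend its centre to `X'` (Lemma 2.1.1) and blow `X'` up along the extension
  obtain ⟨J', hJ'I', hJ'supp⟩ := exists_idealSheaf_extension_fromSpecStalk f x I'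
  obtain ⟨X'', f', hf'⟩ := exists_isBlowup X' J'
  -- the new centre lies over the closure of `x`, inside `C ⊆ T`
  have hIx : ∀ s ∈ (I'.support : Set ↑(pullback f (X.fromSpecStalk x))),
      f (pullback.fst f (X.fromSpecStalk x) s) = x := fun s hs => by
    rw [hfj, hsing s (hI' hs), Scheme.fromSpecStalk_closedPoint]
  have hJ'C : f '' (J'.support : Set X') ⊆ (C : Set X) := by
    rw [hJ'supp]
    refine (image_closure_subset_closure_image f.continuous).trans ?_
    refine C.isClosed.closure_subset_iff.mpr ?_
    rintro _ ⟨_, ⟨s, hs, rfl⟩, rfl⟩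
    rw [hIx s hs]
    exact hxC
  have hJ'T : (J'.support : Set X') ⊆ f ⁻¹' T := fun x' hx' => hCT (hJ'C ⟨x', hx', rfl⟩)
  -- so the composite is a `T`-supported blow-up of `X` (Lemma 2.1.4)
  obtain ⟨J₂, hf₂, hJ₂⟩ := hf.exists_isBlowup_comp_supported f J f' J' T hJ hf' hJ'T
  -- `X''` is of finite type over `k`: its singular locus is closed, with closed image `C'`
  haveI : IsProper f' := hf'.isProper
  have hreg'' : IsClosed (Scheme.regularLocus X'')ᶜ :=
    isClosed_compl_regularLocus_of_locallyOfFiniteType ((f' ≫ f) ≫ f₀) hk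
  let C' : Closeds X :=
    ⟨(f' ≫ f) '' (Scheme.regularLocus X'')ᶜ, (f' ≫ f).isClosedMap _ hreg''⟩
  -- `C' ⊆ C ∖ {x}`
  have hC'C : (C' : Set X) ⊆ (C : Set X) \ {x} := by
    rintro _ ⟨x'', hx'', rfl⟩
    refine ⟨?_, ?_⟩
    · -- over `X ∖ C`: `X'` is regular there and `f'` is an isomorphism off its centre
      by_contra hy
      have hy' : f (f' x'') ∉ (C : Set X) := by rwa [Scheme.Hom.comp_apply] at hy
      have h1 : f' x'' ∈ Scheme.regularLocus X' := hreg _ hy'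
      have h2 : f' x'' ∉ (J'.support : Set X') := fun h => hy' (hJ'C ⟨_, h, rfl⟩)
      haveI := hf'.isIso_compl
      exact hx'' ((mem_regularLocus_iff_of_isIso_morphismRestrict f'
        ⟨(J'.support : Set X')ᶜ, J'.support.isClosed.isOpen_compl⟩ x'' h2).mpr h1)
    · -- over `x`: `X'' ×_{X'} S'` is the regular scheme `S''` (flat base change, uniqueness)
      intro hyx
      rw [Set.mem_singleton_iff, Scheme.Hom.comp_apply] at hyx
      obtain ⟨s, hs⟩ := mem_range_pullback_fst_fromSpecStalk_of_eq f x hyx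
      have hT' : IsBlowup (pullback.snd f' (pullback.fst f (X.fromSpecStalk x))) I' := by
        rw [← hJ'I']
        exact hf'.pullback_snd_of_flat _
      obtain ⟨e, -, -⟩ := hT'.unique hg'
      have hx''range : x'' ∈ Set.range (pullback.fst f' (pullback.fst f (X.fromSpecStalk x))) := by
        rw [Scheme.Pullback.range_fst]
        exact ⟨s, hs⟩
      obtain ⟨t, rfl⟩ := hx''range
      apply hx''
      refine (mem_regularLocus_iff_of_flat_of_isPreimmersion _ t).mp ?_
      exact (mem_regularLocus_iff_of_flat_of_isPreimmersion e.hom t).mpr (hS''reg _)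
  have hlt : C' < C := by
    refine lt_of_le_of_ne (fun y hy => (hC'C hy).1) fun h => ?_
    have hx' : x ∈ (C' : Set X) := by
      rw [h]
      exact hxC
    exact (hC'C hx').2 rfl
  exact ih C' hlt (fun y hy => hCT (hC'C hy).1)
    ⟨X'', f' ≫ f, J₂, hf₂, hJ₂, fun x'' hx'' => by
      by_contra h
      exact hx'' ⟨x'', h, rfl⟩⟩

/-! ## The local rings of a quasi-excellent scheme -/

/-- **The local rings of a quasi-excellent scheme are quasi-excellent**: `𝒪_{X,x}` is the
localization of the quasi-excellent ring `Γ(X, U)` (`U ∋ x` affine) at a prime, and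
localizations of quasi-excellent rings are quasi-excellent (Stacks 07QU, localization clause,
PROVED as `Stacks07QU_localization_holds`). [cite: StacksProject, Tag 07QU] -/
theorem Scheme.IsQuasiExcellent.isQuasiExcellentRing_stalk {X : Scheme.{u}}
    (hX : Scheme.IsQuasiExcellent X) (x : X) : IsQuasiExcellentRing (X.presheaf.stalk x) := by
  obtain ⟨U, hU, hxU, -⟩ :=
    exists_isAffineOpen_mem_and_subset (X := X) (x := x) (U := ⊤) trivial
  letI : Algebra Γ(X, U) (X.presheaf.stalk x) :=
    TopCat.Presheaf.algebra_section_stalk X.presheaf (⟨x, hxU⟩ : U)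
  have hloc : IsLocalization.AtPrime (X.presheaf.stalk x) (hU.primeIdealOf ⟨x, hxU⟩).asIdeal :=
    hU.isLocalization_stalk ⟨x, hxU⟩
  exact isQuasiExcellentRing_of_isLocalization (hU.primeIdealOf ⟨x, hxU⟩).asIdeal.primeCompl
    (hX ⟨U, hU⟩)

/-! ## Thm. 2.3.6 from Hironaka's theorem alone -/

/-- **Hironaka's theorem supplies the local hypothesis at the points of a quasi-excellent
scheme of residue characteristic zero** (Temkin 2008, proof of Thm. 2.3.6: "Accordingly to
proposition 2.3.4, Hironaka's result implies the following theorem"): for `x ∈ X` with `𝒪_{X,x}`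
a domain, `𝒪_{X,x}` is a local quasi-excellent ring (`isQuasiExcellentRing_stalk`) whose residue
field has characteristic zero (`charZero_residueField_stalk`); a blow-up `S'` of `Spec 𝒪_{X,x}`
along a nonzero ideal is integral and proper over it, so `Hironaka1964_local` desingularizes
it, and along the zero ideal `S' = ∅`. [cite: Temkin2008, Thm. 2.3.6 (proof, p. 13)] -/
theorem Hironaka1964_local.admitsDesingularization_of_isBlowup_stalk
    (hH : Hironaka1964_local.{u}) {X : Scheme.{u}} (hX : Scheme.IsQuasiExcellent X)
    (h0 : ∀ y : X, CharZero (X.residueField y)) (x : X) [IsDomain (X.presheaf.stalk x)]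
    {S' : Scheme.{u}} {g : S' ⟶ Spec (X.presheaf.stalk x)}
    {I : (Spec (X.presheaf.stalk x)).IdealSheafData} (hg : IsBlowup g I) :
    Scheme.AdmitsDesingularization S' := by
  by_cases hI : I = ⊥
  · subst hI
    haveI := hg.isEmpty_of_bot
    exact Scheme.admitsDesingularization_of_isEmpty S'
  have hA : IsQuasiExcellentRing (X.presheaf.stalk x) := hX.isQuasiExcellentRing_stalk x
  have hA0 : CharZero (ResidueField (X.presheaf.stalk x)) := charZero_residueField_stalk (𝟙 X) h0 x
  haveI : IsNoetherianRing (X.presheaf.stalk x) := hA.isNoetherianRing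
  haveI : IsIntegral S' := hg.isIntegral hI
  haveI : IsProper g := hg.isProper
  exact hH (X.presheaf.stalk x) hA hA0 S' g

/-- **`Hironaka1964_local → Temkin2008`** (Temkin 2008, Thm. 2.3.6 with `Z = ∅`, weak form): for
a Noetherian quasi-excellent integral scheme `X` whose residue fields have characteristic zero,
Prop. 2.3.4 for the `X`-scheme `X` itself (`admitsDesingularization_of_local` over the base
`k = X`, identity structure map) needs the local hypothesis only at the points of `X`, where
Hironaka's theorem over the local quasi-excellent rings `𝒪_{X,x}` provides it
(`Hironaka1964_local.admitsDesingularization_of_isBlowup_stalk`); the resulting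
desingularization is a resolution (`Scheme.AdmitsDesingularization.hasResolution`). After this
theorem the trust base of the named fact `Temkin2008` is the single leaf `Hironaka1964_local`.
[cite: Temkin2008, Thm. 2.3.6 and Prop. 2.3.4] [cite: Hironaka1964, Main Theorem I] -/
theorem temkin2008_of_hironaka1964_local (hH : Hironaka1964_local.{u}) : Temkin2008.{u} := by
  intro X _ _ hqe h0
  have hdes : Scheme.AdmitsDesingularization X :=
    admitsDesingularization_of_local (k := X) hqe (𝟙 X) fun x _S' _g _I hg _ =>
      hH.admitsDesingularization_of_isBlowup_stalk hqe h0 x hg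
  exact hdes.hasResolution

/-- The same, phrased on desingularizations in Temkin's sense (Def. 2.2.6: an `X_reg`-admissible
blow-up with regular source), which is what the proof produces: under `Hironaka1964_local`,
every Noetherian quasi-excellent scheme with residue fields of characteristic zero and integral
local rings admits a desingularization. [cite: Temkin2008, Thm. 2.3.6] -/
theorem Hironaka1964_local.admitsDesingularization (hH : Hironaka1964_local.{u}) (X : Scheme.{u})
    [IsNoetherian X] (hqe : Scheme.IsQuasiExcellent X) (h0 : ∀ x : X, CharZero (X.residueField x))
    (hdom : ∀ x : X, IsDomain (X.presheaf.stalk x)) : Scheme.AdmitsDesingularization X :=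
  admitsDesingularization_of_local (k := X) hqe (𝟙 X) fun x _S' _g _I hg _ =>
    haveI := hdom x
    hH.admitsDesingularization_of_isBlowup_stalk hqe h0 x hg

end Literature.AlgebraicGeometry.Resolution

end
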